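import Literature.Analysis.FluidPDE.HardSpherePhaseSpace
import HarnessLib

/-!
# Hard-body mixtures: the collision law with masses and the mixture phase space

Static part of the polydisperse (hard-body mixture) model of
`Literature.Analysis.FluidPDE.PolydisperseHardSphereFlow`: `N` particles with per-particle
masses `m : Fin N → ℝ` and diameters `σ : Fin N → ℝ` in a geometry `G : Geometry d X`
(Ampatzoglou–Miller–Pavlović 2022 §2.1–2.2, §3.1: two species of hard spheres in `ℝ^d`;
Spohn 1991 §8.2 (8.1)–(8.2): the Rayleigh gas, a tracer sphere of mass `M` in an ideal gas of
point particles of mass `m`):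

* `reflectVelMass mi mj n (v, w)` — the elastic collision law with masses
  `v' = v - (2 mj/(mi+mj)) (⟪v - w, n⟫/|n|²) n`, `w' = w + (2 mi/(mi+mj)) (⟪v - w, n⟫/|n|²) n`
  (AMP 2022 §2.2; Spohn 1991 (8.2)): conserves `mi v + mj w` and `mi|v|² + mj|w|²`, is an
  involution, reverses the normal relative velocity, and equals the tree's `reflectVel` for
  `mi = mj`;
* `contactRadius σ i j = (σ i + σ j)/2` (additive contact distance, AMP 2022 §2.1),
  `polyHardSphereDomain G σ = {∀ i ≠ j, (σ i + σ j)/2 ≤ |x_i - x_j|}`, `polyContactSet G σ i j`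
  (contact set of an *interacting* pair, i.e. one of positive contact distance — two point
  particles never interact, the ideal-gas convention `U = 0` of Spohn 1991 §8.2),
  `polyLiouville G σ` (Lebesgue measure restricted to the domain);
* `configEnergyMass`, `configMomentumMass`, `collidePairMass G m i j` (the binary collision of
  the pair `(i, j)` in a configuration) with conservation, involution, in/out exchange;
* the monodisperse identities `polyHardSphereDomain_const`, `polyContactSet_const`,
  `polyLiouville_const`, `collidePairMass_const` with `HardSpherePhaseSpace`.

Design: per-particle parameters (species = fibres of `(m, σ)`) on one configuration type
`Config N d X`; no positivity baked in (documented junk values: `reflectVelMass mi mj 0 = id`, and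
`= id` when `mi + mj = 0`, Lean's `x / 0 = 0`); the invariant measure is plain Lebesgue measure
(the mass law has Jacobian `-1` in `(v_i, v_j)`, AMP 2022 Thm 3.1), not a mass-weighted one.

## References

* I. Ampatzoglou, J. K. Miller, N. Pavlović, *A rigorous derivation of a Boltzmann system for a
  mixture of hard-sphere gases*, SIAM J. Math. Anal. 54 (2022), arXiv:2104.14480, §2.1–2.2, §3.1.
* H. Spohn, *Large Scale Dynamics of Interacting Particles* (1991), §8.2, (8.1)–(8.2).
-/

open MeasureTheory Set
open scoped InnerProductSpace

namespace Literature.Analysis.FluidPDE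

noncomputable section

section CollisionLaw

variable {E : Type*} [NormedAddCommGroup E] [InnerProductSpace ℝ E]

/-- The elastic collision law for two particles of masses `mi`, `mj` with velocities
`p = (v, w)` and (unnormalised) impact direction `n = x_i - x_j`:
`v' = v - (2 mj/(mi+mj)) (⟪v - w, n⟫/|n|²) n`, `w' = w + (2 mi/(mi+mj)) (⟪v - w, n⟫/|n|²) n`
(Ampatzoglou–Miller–Pavlović 2022 §2.2; Spohn 1991 (8.2) with `M = mi`, `m = mj`). For
`mi = mj ≠ 0` this is `reflectVel n` (`reflectVelMass_self`). Junk values: the identity at `n = 0`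
and when `mi + mj = 0`. [cite: AmpatzoglouMillerPavlovic2022, §2.2 collision law] -/
def reflectVelMass (mi mj : ℝ) (n : E) (p : E × E) : E × E :=
  (p.1 - (2 * mj / (mi + mj) * (⟪p.1 - p.2, n⟫_ℝ / ‖n‖ ^ 2)) • n,
   p.2 + (2 * mi / (mi + mj) * (⟪p.1 - p.2, n⟫_ℝ / ‖n‖ ^ 2)) • n)

/-- At `n = 0` the mass collision law is the identity (documented junk value). [folklore] -/
@[simp]
theorem reflectVelMass_zero (mi mj : ℝ) (p : E × E) : reflectVelMass mi mj (0 : E) p = p := by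
  simp [reflectVelMass]

/-- For equal (nonzero) masses the mass collision law is the equal-mass reflection law
`reflectVel` of `HardSpherePhaseSpace` (`2m/(m+m) = 1`). [folklore] -/
theorem reflectVelMass_self {m : ℝ} (hm : m ≠ 0) (n : E) (p : E × E) :
    reflectVelMass m m n p = reflectVel n p := by
  have h : 2 * m / (m + m) = 1 := by
    rw [← two_mul, div_self (mul_ne_zero two_ne_zero hm)]
  simp [reflectVelMass, reflectVel, h]

/-- Conservation of momentum `mi v' + mj w' = mi v + mj w` (AMP 2022 §2.2, conservation of momentum;
no hypothesis on the masses is needed). [cite: AmpatzoglouMillerPavlovic2022, §2.2] -/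
theorem reflectVelMass_momentum (mi mj : ℝ) (n : E) (p : E × E) :
    mi • (reflectVelMass mi mj n p).1 + mj • (reflectVelMass mi mj n p).2 = mi • p.1 + mj • p.2 := by
  simp only [reflectVelMass, smul_sub, smul_add, smul_smul]
  have h : mi * (2 * mj / (mi + mj) * (⟪p.1 - p.2, n⟫_ℝ / ‖n‖ ^ 2)) =
      mj * (2 * mi / (mi + mj) * (⟪p.1 - p.2, n⟫_ℝ / ‖n‖ ^ 2)) := by ring
  rw [h]
  abel

/-- The relative velocity after the collision is the reflected relative velocity
`v' - w' = (v - w) - 2 (⟪v - w, n⟫/|n|²) n` (for `mi + mj ≠ 0`), as in the equal-mass law. [folklore] -/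
theorem reflectVelMass_fst_sub_snd {mi mj : ℝ} (hM : mi + mj ≠ 0) (n : E) (p : E × E) :
    (reflectVelMass mi mj n p).1 - (reflectVelMass mi mj n p).2 =
      (p.1 - p.2) - (2 * (⟪p.1 - p.2, n⟫_ℝ / ‖n‖ ^ 2)) • n := by
  have h : 2 * (⟪p.1 - p.2, n⟫_ℝ / ‖n‖ ^ 2) = 2 * mj / (mi + mj) * (⟪p.1 - p.2, n⟫_ℝ / ‖n‖ ^ 2) +
      2 * mi / (mi + mj) * (⟪p.1 - p.2, n⟫_ℝ / ‖n‖ ^ 2) := by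
    field_simp
    ring
  simp only [reflectVelMass]
  rw [h, add_smul]
  abel

/-- The mass collision law reverses the normal component of the relative velocity:
`⟪v' - w', n⟫/|n|² = -⟪v - w, n⟫/|n|²` (`n ≠ 0`, `mi + mj ≠ 0`). [folklore] -/
theorem inner_reflectVelMass_fst_sub_snd_div {mi mj : ℝ} (hM : mi + mj ≠ 0) {n : E} (hn : n ≠ 0)
    (p : E × E) :
    ⟪(reflectVelMass mi mj n p).1 - (reflectVelMass mi mj n p).2, n⟫_ℝ / ‖n‖ ^ 2 =
      -(⟪p.1 - p.2, n⟫_ℝ / ‖n‖ ^ 2) := by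
  have hn2 : ‖n‖ ^ 2 ≠ 0 := pow_ne_zero 2 (norm_ne_zero_iff.2 hn)
  rw [reflectVelMass_fst_sub_snd hM, inner_sub_left, real_inner_smul_left,
    real_inner_self_eq_norm_sq]
  field_simp
  ring

/-- The mass collision law exchanges incoming and outgoing pairs:
`⟪n, v' - w'⟫ = -⟪n, v - w⟫` for `n ≠ 0`, `mi + mj ≠ 0` (AMP 2022 Remark 3.1). [cite: AmpatzoglouMillerPavlovic2022, Remark 3.1] -/
theorem inner_reflectVelMass_fst_sub_snd {mi mj : ℝ} (hM : mi + mj ≠ 0) {n : E} (hn : n ≠ 0)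
    (p : E × E) :
    ⟪n, (reflectVelMass mi mj n p).1 - (reflectVelMass mi mj n p).2⟫_ℝ = -⟪n, p.1 - p.2⟫_ℝ := by
  have hn2 : ‖n‖ ^ 2 ≠ 0 := pow_ne_zero 2 (norm_ne_zero_iff.2 hn)
  have h := inner_reflectVelMass_fst_sub_snd_div hM hn p
  rw [real_inner_comm _ n, real_inner_comm _ n]
  field_simp at h
  linarith

/-- The mass collision law is an involution (AMP 2022 Remark 3.1: "`T` is an involution"; no
hypothesis needed thanks to the junk values). [cite: AmpatzoglouMillerPavlovic2022, Remark 3.1] -/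
theorem reflectVelMass_reflectVelMass (mi mj : ℝ) (n : E) (p : E × E) :
    reflectVelMass mi mj n (reflectVelMass mi mj n p) = p := by
  by_cases hM : mi + mj = 0
  · simp [reflectVelMass, hM]
  by_cases hn : n = 0
  · simp [hn]
  have key := inner_reflectVelMass_fst_sub_snd_div hM hn p
  set q := reflectVelMass mi mj n p with hq
  have h1 : q.1 = p.1 - (2 * mj / (mi + mj) * (⟪p.1 - p.2, n⟫_ℝ / ‖n‖ ^ 2)) • n := rfl
  have h2 : q.2 = p.2 + (2 * mi / (mi + mj) * (⟪p.1 - p.2, n⟫_ℝ / ‖n‖ ^ 2)) • n := rfl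
  show (q.1 - (2 * mj / (mi + mj) * (⟪q.1 - q.2, n⟫_ℝ / ‖n‖ ^ 2)) • n,
    q.2 + (2 * mi / (mi + mj) * (⟪q.1 - q.2, n⟫_ℝ / ‖n‖ ^ 2)) • n) = p
  rw [key, h1, h2]
  ext
  · simp only [mul_neg, neg_smul]
    abel
  · simp only [mul_neg, neg_smul]
    abel

/-- Conservation of kinetic energy `mi |v'|² + mj |w'|² = mi |v|² + mj |w|²` (AMP 2022 §2.2,
conservation of energy; no hypothesis needed thanks to the junk values). [cite: AmpatzoglouMillerPavlovic2022, §2.2] -/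
theorem reflectVelMass_energy (mi mj : ℝ) (n : E) (p : E × E) :
    mi * ‖(reflectVelMass mi mj n p).1‖ ^ 2 + mj * ‖(reflectVelMass mi mj n p).2‖ ^ 2 =
      mi * ‖p.1‖ ^ 2 + mj * ‖p.2‖ ^ 2 := by
  by_cases hM : mi + mj = 0
  · simp [reflectVelMass, hM]
  by_cases hn : n = 0
  · simp [hn]
  have hn2 : ‖n‖ ^ 2 ≠ 0 := pow_ne_zero 2 (norm_ne_zero_iff.2 hn)
  simp only [reflectVelMass, norm_sub_sq_real, norm_add_sq_real, norm_smul, mul_pow,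
    Real.norm_eq_abs, sq_abs, real_inner_smul_right, inner_sub_left]
  field_simp
  ring

end CollisionLaw

section Mixture

variable {N : ℕ}

/-- The contact (interaction) distance of particles `i` and `j` with diameters `σ i`, `σ j`:
`(σ i + σ j) / 2` (additive hard spheres; AMP 2022 §2.1, `ε_(α,β) = (ε_α + ε_β)/2`). [cite: AmpatzoglouMillerPavlovic2022, §2.1] -/
def contactRadius (σ : Fin N → ℝ) (i j : Fin N) : ℝ := (σ i + σ j) / 2

/-- The contact distance is symmetric. [folklore] -/
theorem contactRadius_comm (σ : Fin N → ℝ) (i j : Fin N) :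
    contactRadius σ i j = contactRadius σ j i := by
  unfold contactRadius
  rw [add_comm]

/-- For a constant diameter `ε` every contact distance is `ε`. [folklore] -/
@[simp]
theorem contactRadius_const (ε : ℝ) (i j : Fin N) : contactRadius (fun _ : Fin N => ε) i j = ε := by
  unfold contactRadius
  ring

/-- Nonnegative diameters give nonnegative contact distances. [folklore] -/
theorem contactRadius_nonneg {σ : Fin N → ℝ} (hσ : ∀ i, 0 ≤ σ i) (i j : Fin N) :
    0 ≤ contactRadius σ i j := by
  unfold contactRadius
  linarith [hσ i, hσ j]

/-- A pair one of whose members has positive diameter has positive contact distance. [folklore] -/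
theorem contactRadius_pos {σ : Fin N → ℝ} {i j : Fin N} (hi : 0 < σ i) (hj : 0 ≤ σ j) :
    0 < contactRadius σ i j := by
  unfold contactRadius
  linarith

variable {d : Type*} [Fintype d] {X : Type*}

/-- The hard-body mixture domain: configurations with `(σ i + σ j)/2 ≤ |x_i - x_j|` for all
`i ≠ j` (closed version, contact configurations included; AMP 2022 §2.1, the phase space `𝒟`).
For two point particles (`σ i = σ j = 0`) the constraint is vacuous. [cite: AmpatzoglouMillerPavlovic2022, §2.1 phase space] -/
def polyHardSphereDomain (G : Geometry d X) (σ : Fin N → ℝ) : Set (Config N d X) :=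
  {z | ∀ i j, i ≠ j → contactRadius σ i j ≤ ‖G.sepVec (z i).1 (z j).1‖}

/-- Membership in the mixture domain. [folklore] -/
theorem mem_polyHardSphereDomain {G : Geometry d X} {σ : Fin N → ℝ} {z : Config N d X} :
    z ∈ polyHardSphereDomain G σ ↔
      ∀ i j, i ≠ j → contactRadius σ i j ≤ ‖G.sepVec (z i).1 (z j).1‖ :=
  Iff.rfl

/-- The contact set of an *interacting* pair `(i, j)` (positive contact distance): configurations
of the domain with `|x_i - x_j| = (σ i + σ j)/2` (AMP 2022 §3.1, `Σ_(i,j)`). Pairs with zero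
contact distance (two points) never interact: their contact set is empty (ideal-gas convention,
Spohn 1991 §8.2, `U = 0`). [cite: AmpatzoglouMillerPavlovic2022, §3.1] -/
def polyContactSet (G : Geometry d X) (σ : Fin N → ℝ) (i j : Fin N) : Set (Config N d X) :=
  {z ∈ polyHardSphereDomain G σ |
    0 < contactRadius σ i j ∧ ‖G.sepVec (z i).1 (z j).1‖ = contactRadius σ i j}

/-- Membership in a contact set. [folklore] -/
theorem mem_polyContactSet {G : Geometry d X} {σ : Fin N → ℝ} {i j : Fin N} {z : Config N d X} :
    z ∈ polyContactSet G σ i j ↔ z ∈ polyHardSphereDomain G σ ∧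
      0 < contactRadius σ i j ∧ ‖G.sepVec (z i).1 (z j).1‖ = contactRadius σ i j :=
  Iff.rfl

/-- The invariant (Liouville) measure of the mixture: Lebesgue measure `∏ dx_i dv_i` restricted to
the mixture domain (AMP 2022 Thm 3.1: the mixed flow preserves this measure; the masses do not
enter). [cite: AmpatzoglouMillerPavlovic2022, §3 Thm 3.1] -/
def polyLiouville [MeasureSpace X] (G : Geometry d X) (σ : Fin N → ℝ) : Measure (Config N d X) :=
  volume.restrict (polyHardSphereDomain G σ)

/-- Monodisperse case: for a constant diameter `ε` the mixture domain is the hard-sphere domain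
`D_ε^N`. [folklore] -/
theorem polyHardSphereDomain_const (G : Geometry d X) (N : ℕ) (ε : ℝ) :
    polyHardSphereDomain G (fun _ : Fin N => ε) = hardSphereDomain G N ε := by
  ext z
  simp [mem_polyHardSphereDomain, mem_hardSphereDomain]

/-- Monodisperse case: for a constant positive diameter the contact sets are the hard-sphere
contact sets. [folklore] -/
theorem polyContactSet_const (G : Geometry d X) {ε : ℝ} (hε : 0 < ε) (i j : Fin N) :
    polyContactSet G (fun _ : Fin N => ε) i j = contactSet G N ε i j := by
  ext z
  simp [mem_polyContactSet, mem_contactSet, polyHardSphereDomain_const, hε]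

/-- Monodisperse case: the Liouville measures agree. [folklore] -/
theorem polyLiouville_const [MeasureSpace X] (G : Geometry d X) (N : ℕ) (ε : ℝ) :
    polyLiouville G (fun _ : Fin N => ε) = liouville G N ε := by
  rw [polyLiouville, polyHardSphereDomain_const, liouville_eq]

/-- The kinetic energy `½ ∑ mᵢ |vᵢ|²` of a configuration with masses `m` (AMP 2022 Def. 3.3, up to
the factor `½`). [cite: AmpatzoglouMillerPavlovic2022, §3.1 Def. 3.3] -/
def configEnergyMass (m : Fin N → ℝ) (z : Config N d X) : ℝ := 2⁻¹ * ∑ i, m i * ‖(z i).2‖ ^ 2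

omit [Fintype d] in
/-- The total momentum `∑ mᵢ vᵢ` of a configuration with masses `m`. [folklore] -/
def configMomentumMass (m : Fin N → ℝ) (z : Config N d X) : EuclideanSpace ℝ d :=
  ∑ i, m i • (z i).2

/-- Unit masses: `configEnergyMass 1 = configEnergy`. [folklore] -/
@[simp]
theorem configEnergyMass_one (z : Config N d X) :
    configEnergyMass (fun _ => 1) z = configEnergy z := by
  simp [configEnergyMass, configEnergy]

omit [Fintype d] in
/-- Unit masses: `configMomentumMass 1 = configMomentum`. [folklore] -/
@[simp]
theorem configMomentumMass_one (z : Config N d X) :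
    configMomentumMass (fun _ => 1) z = configMomentum z := by
  simp [configMomentumMass, configMomentum]

/-- Free flight preserves the mass-weighted kinetic energy. [folklore] -/
@[simp]
theorem configEnergyMass_freeFlight (G : Geometry d X) (m : Fin N → ℝ) (t : ℝ) (z : Config N d X) :
    configEnergyMass m (freeFlight G t z) = configEnergyMass m z := rfl

/-- Free flight preserves the total momentum. [folklore] -/
@[simp]
theorem configMomentumMass_freeFlight (G : Geometry d X) (m : Fin N → ℝ) (t : ℝ)
    (z : Config N d X) : configMomentumMass m (freeFlight G t z) = configMomentumMass m z := rfl

/-- The elastic collision of the pair `(i, j)` with masses `m i`, `m j`: positions unchanged, the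
velocities `(v_i, v_j)` replaced by `reflectVelMass (m i) (m j) (x_i - x_j) (v_i, v_j)`
(AMP 2022 Def. 3.2, the impact operator `T_(i,j)`; Spohn 1991 (8.2)). Only meaningful for
`i ≠ j`. [cite: AmpatzoglouMillerPavlovic2022, §3.1 Def. 3.2] -/
def collidePairMass (G : Geometry d X) (m : Fin N → ℝ) (i j : Fin N) (z : Config N d X) :
    Config N d X :=
  Function.update (Function.update z i
    ((z i).1, (reflectVelMass (m i) (m j) (G.sepVec (z i).1 (z j).1) ((z i).2, (z j).2)).1)) j
    ((z j).1, (reflectVelMass (m i) (m j) (G.sepVec (z i).1 (z j).1) ((z i).2, (z j).2)).2)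

variable {G : Geometry d X} {m : Fin N → ℝ} {i j : Fin N}

/-- After the collision of `(i, j)`, particle `i` has velocity `v_i'` and unchanged position. [folklore] -/
theorem collidePairMass_apply_left (hij : i ≠ j) (z : Config N d X) :
    collidePairMass G m i j z i =
      ((z i).1, (reflectVelMass (m i) (m j) (G.sepVec (z i).1 (z j).1) ((z i).2, (z j).2)).1) := by
  simp [collidePairMass, Function.update_of_ne hij]

/-- After the collision of `(i, j)`, particle `j` has velocity `v_j'` and unchanged position. [folklore] -/
theorem collidePairMass_apply_right (z : Config N d X) :
    collidePairMass G m i j z j =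
      ((z j).1, (reflectVelMass (m i) (m j) (G.sepVec (z i).1 (z j).1) ((z i).2, (z j).2)).2) := by
  simp [collidePairMass]

/-- Particles other than `i, j` are unaffected by the collision of `(i, j)`. [folklore] -/
theorem collidePairMass_apply_of_ne {k : Fin N} (hki : k ≠ i) (hkj : k ≠ j) (z : Config N d X) :
    collidePairMass G m i j z k = z k := by
  simp [collidePairMass, Function.update_of_ne hki, Function.update_of_ne hkj]

/-- A collision does not move the particles. [folklore] -/
@[simp]
theorem collidePairMass_apply_fst (z : Config N d X) (k : Fin N) :
    (collidePairMass G m i j z k).1 = (z k).1 := by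
  by_cases hkj : k = j
  · subst hkj; rw [collidePairMass_apply_right]
  by_cases hki : k = i
  · subst hki; rw [collidePairMass_apply_left hkj]
  rw [collidePairMass_apply_of_ne hki hkj]

/-- Equal nonzero masses: the mass collision is the tree's equal-mass collision `collidePair`. [folklore] -/
theorem collidePairMass_const {μ : ℝ} (hμ : μ ≠ 0) (i j : Fin N) (z : Config N d X) :
    collidePairMass G (fun _ : Fin N => μ) i j z = collidePair G i j z := by
  simp only [collidePairMass, collidePair, reflectVelMass_self hμ]

/-- Collisions do not move particles, so they preserve the mixture domain. [folklore] -/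
theorem collidePairMass_mem_polyHardSphereDomain_iff {σ : Fin N → ℝ} (z : Config N d X) :
    collidePairMass G m i j z ∈ polyHardSphereDomain G σ ↔ z ∈ polyHardSphereDomain G σ := by
  simp [mem_polyHardSphereDomain]

omit [Fintype d] in
/-- A sum over `Fin N` is unchanged if the summand changes only at `i ≠ j` with the same
two-term sum there. [folklore] -/
private theorem sum_eq_sum_of_pair_mass {M : Type*} [AddCommMonoid M] (hij : i ≠ j)
    {f g : Fin N → M} (hfg : f i + f j = g i + g j) (h : ∀ k, k ≠ i → k ≠ j → f k = g k) :
    ∑ k, f k = ∑ k, g k := by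
  have hj : j ∈ Finset.univ.erase i := Finset.mem_erase.2 ⟨hij.symm, Finset.mem_univ j⟩
  rw [← Finset.add_sum_erase _ _ (Finset.mem_univ i), ← Finset.add_sum_erase _ _ hj,
    ← Finset.add_sum_erase _ _ (Finset.mem_univ i), ← Finset.add_sum_erase _ _ hj,
    ← add_assoc, ← add_assoc, hfg]
  congr 1
  refine Finset.sum_congr rfl fun k hk => ?_
  simp only [Finset.mem_erase] at hk
  exact h k hk.2.1 hk.1

/-- A binary collision with masses conserves the mass-weighted kinetic energy
(AMP 2022 Remark 3.2). [cite: AmpatzoglouMillerPavlovic2022, Remark 3.2] -/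
theorem configEnergyMass_collidePairMass (hij : i ≠ j) (z : Config N d X) :
    configEnergyMass m (collidePairMass G m i j z) = configEnergyMass m z := by
  unfold configEnergyMass
  congr 1
  refine sum_eq_sum_of_pair_mass hij ?_ fun k hki hkj => by
    rw [collidePairMass_apply_of_ne hki hkj]
  rw [collidePairMass_apply_left hij, collidePairMass_apply_right]
  exact reflectVelMass_energy _ _ _ _

/-- A binary collision with masses conserves the total momentum `∑ mᵢ vᵢ`. [folklore] -/
theorem configMomentumMass_collidePairMass (hij : i ≠ j) (z : Config N d X) :
    configMomentumMass m (collidePairMass G m i j z) = configMomentumMass m z := by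
  unfold configMomentumMass
  refine sum_eq_sum_of_pair_mass hij ?_ fun k hki hkj => by
    rw [collidePairMass_apply_of_ne hki hkj]
  rw [collidePairMass_apply_left hij, collidePairMass_apply_right]
  exact reflectVelMass_momentum _ _ _ _

/-- The binary collision with masses is an involution. [folklore] -/
theorem collidePairMass_collidePairMass (hij : i ≠ j) (z : Config N d X) :
    collidePairMass G m i j (collidePairMass G m i j z) = z := by
  have hn : G.sepVec (collidePairMass G m i j z i).1 (collidePairMass G m i j z j).1 =
      G.sepVec (z i).1 (z j).1 := by
    simp
  have hp : ((collidePairMass G m i j z i).2, (collidePairMass G m i j z j).2) =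
      reflectVelMass (m i) (m j) (G.sepVec (z i).1 (z j).1) ((z i).2, (z j).2) := by
    rw [collidePairMass_apply_left hij, collidePairMass_apply_right]
  funext k
  by_cases hkj : k = j
  · subst hkj
    rw [collidePairMass_apply_right, hn, hp, reflectVelMass_reflectVelMass,
      collidePairMass_apply_fst]
  by_cases hki : k = i
  · subst hki
    rw [collidePairMass_apply_left hkj, hn, hp, reflectVelMass_reflectVelMass,
      collidePairMass_apply_fst]
  rw [collidePairMass_apply_of_ne hki hkj, collidePairMass_apply_of_ne hki hkj]

/-- The mass collision law exchanges pre- and post-collisional configurations: `(i, j)` is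
outgoing after the collision iff it was incoming before (AMP 2022 Remark 3.1; for `i ≠ j` and
`m i + m j ≠ 0`; if the separation vector vanishes both sides are false). [cite: AmpatzoglouMillerPavlovic2022, Remark 3.1] -/
theorem isOutgoing_collidePairMass_iff (hij : i ≠ j) (hM : m i + m j ≠ 0) (z : Config N d X) :
    IsOutgoing G (collidePairMass G m i j z) i j ↔ IsIncoming G z i j := by
  unfold IsOutgoing IsIncoming
  have hn : G.sepVec (collidePairMass G m i j z i).1 (collidePairMass G m i j z j).1 =
      G.sepVec (z i).1 (z j).1 := by
    simp
  rw [hn, collidePairMass_apply_left hij, collidePairMass_apply_right]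
  by_cases h0 : G.sepVec (z i).1 (z j).1 = 0
  · simp [h0]
  rw [inner_reflectVelMass_fst_sub_snd hM h0, neg_pos]

end Mixture

end

end Literature.Analysis.FluidPDE
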